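/-
Copyright: the b2b-balaban cell (near-miss cell 7), T⁴-continuum fan-out; row NE7b ROUND-2 swarm, seat
t4-ne7b-formalise-leaf-05 gen 4 (row S6g′ INSTANCE of `t4/b2b-balaban-t4-ne7b-p1/LEAVES-NE7b.md`, owner's rulings
R-OWNER-23-3∕-4∕-5∕-6∕-7: T3b, file 2 «PHYS»).  Released under the licence of the surrounding project.
-/
import Summits.QuantumFields.BalabanUV.T4Continuum.Support.HistoryJoinsPlacedValue
import Summits.QuantumFields.BalabanUV.T4Continuum.Support.HistoryMemberPlacementRead
import Summits.QuantumFields.BalabanUV.T4Continuum.Support.HistoryJoinsPlacedZoneRead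

/-!
# T3b, file 2 «PHYS»: the side conditions and the zones of the placement read off a physical member
# (row S6g′ INSTANCE)

Summits-side support leaf of the T⁴-continuum cell (rung (B)+1 on a FINITE torus only; NOT infinite volume, NOT the
mass gap, NOT the Clay statement; NOT a proof of the spine estimate NE7b).  Row NE7b, route «COUNT», row S6g′ INSTANCE,
piece T3b (R-OWNER-23-7: the member's placement is leaf-10 gen 6's `PGen.placed c₀ v g` of `HistoryMemberPlacement`,
instantiated at file 1's value map `v := valP …`).  [folklore] bookkeeping over the lineage's own carriers (file 1's
`valP`∕`cellV`∕`tmplV`∕`toGenL`, leaf-10 gen 6's `placed`∕`bread_placed`, leaf-02 gen 6's `bread`∕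
`image_births_addrTag_nil`, gen 3's `zoneP`∕`regOf`∕`OK`, leaf-07 gen 2's `regZoneD`∕`regR`); nothing is quoted from
print, nothing printed is asserted, no `[cite:]` tag, no `Prop` fact minted, no definition.

WHAT.  For a physical member `g : PGen (Pt d × Finset (Pt d))` of depth `≤ D` placed by
`PGen.placed c₀ (valP n L K hN lv M hM) g`:
* `exists_value_of_mem_births` (the value at a tagged birth of the label is `valP` of a physical birth with that label),
  `leafStep_toGen`;
* **`ok_placed`** — gen 3's side conditions `OK` DISCHARGED (template sizes by `card_tmplV_le`, cells by
  `isScale_cellV`, the root clause by leaf steps = label steps), when the births' levels are `≤ K`;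
* **`coreZoneD_placed`** ∕ **`zoneP_placed`** — under the birth facts (anchor ∈ region, face-connected, `treeLen ≤ fat`;
  leaf-07 gen 2's `births_facts_of_corr` shape) and the type bound `tcap d fat ≤ M`, the COUNT's concrete zone of the
  label `g.toGen` under the member's placement IS leaf-07 gen 2's levelled region reading of the payload-tagged tree:
  `zoneP n L K lv c c₀ t g.toGen (placed …) = regZoneD Prod.fst n L K lv c (regR Prod.fst Prod.snd n L K lv) t (toGenL g)`
  (`file 1`'s identity `redZone_translate_valP` birth by birth) — so realised CONTACT (leaf-07 gen 2's
  `contact_of_corr` on `(toGenL g, g)`) is contact of the count's zones (file 3).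

HONEST SCOPE.  Bookkeeping over OUR carriers; nothing of H3∕(B)∕BetaPertH touched; `hdis`∕`hmult` NOT retired here;
NE7b NOT proved.  HONEST DEPENDENCY (cell): continuum YM on T⁴ ⇐ BetaPertH ∧ nine spine estimates (0/9 proved);
BetaPertH ⇐ (D1) ∧ (D4) ∧ CAP+tail; G-an2-4 gates asym, D1 and NE2/3/4.  This file changes none of it.
-/

open Finset
open Literature.MathematicalPhysics.QuantumFieldTheory.Balaban1983to89
open Literature.MathematicalPhysics.QuantumFieldTheory.Balaban1983to89.B13ScaleTransfer (Pt FaceConnected)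
open Literature.MathematicalPhysics.QuantumFieldTheory.Balaban1983to89.TreeLength (treeLen)
open T4PersistenceDictionary T4PartnerMultiplicity T4BranchingRecordsGas
open Summit.QuantumFields.BalabanUV.T4Continuum.PlacementSkeleton
open Summit.QuantumFields.BalabanUV.T4Continuum.ZoneTorus
open Summit.QuantumFields.BalabanUV.T4Continuum.HistoryZones
open Summit.QuantumFields.BalabanUV.T4Continuum.HistoryAdmissible
open Summit.QuantumFields.BalabanUV.T4Continuum.HistoryJoins
open Summit.QuantumFields.BalabanUV.T4Continuum.HistoryJoinsAdm
open Summit.QuantumFields.BalabanUV.T4Continuum.HistoryJoinsTag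
open Summit.QuantumFields.BalabanUV.T4Continuum.HistoryJoinsSupTorus
open Summit.QuantumFields.BalabanUV.T4Continuum.HistoryJoinsRearrange
open Summit.QuantumFields.BalabanUV.T4Continuum.HistoryRegionTemplates
open Summit.QuantumFields.BalabanUV.T4Continuum.HistoryJoinsTemplates
open Summit.QuantumFields.BalabanUV.T4Continuum.HistoryJoinsPlacedZone
open Summit.QuantumFields.BalabanUV.T4Continuum.HistoryJoinsPlacedTagged
open Summit.QuantumFields.BalabanUV.T4Continuum.HistoryJoinsPlacedValue
open Summit.QuantumFields.BalabanUV.T4Continuum.HistoryJoinsPlacedZoneRead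

namespace Summit.QuantumFields.BalabanUV.T4Continuum.HistoryJoinsPlacedPhys

noncomputable section

open scoped Classical

variable {d n L K D M : ℕ} {lv : ℕ → ℕ} {c : ℕ} {c₀ : TCell d (n * L ^ K) × Template d M}
  (hN : 0 < n * L ^ K) (hM : 1 ≤ M)

/-- leaf steps of the canonical label are label steps [folklore] -/
theorem leafStep_toGen {γ : Type*} : ∀ (g : PGen γ) (b : PEv) (j : ℕ), Sub (Gen.born b j) g.toGen → b.step = j
  | PGen.birth _ _ _, b, j, hS => by
      cases hS with
      | refl => rfl
  | PGen.renew G h, b, j, hS => by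
      cases hS with
      | renew _ _ hs => exact leafStep_toGen G b j hs
  | PGen.join X Y s, b, j, hS => by
      cases hS with
      | left _ _ hs => exact leafStep_toGen X b j hs
      | right _ _ hs => exact leafStep_toGen Y b j hs

/-- **THE VALUE AT A TAGGED BIRTH OF THE LABEL IS THE VALUE OF A PHYSICAL BIRTH WITH THAT LABEL** (depth `≤ D`;
leaf-02 gen 6's bridge `image_births_addrTag_nil` + leaf-10 gen 6's `bread_placed`). [folklore] -/
theorem exists_value_of_mem_births {γ γ' : Type*} [DecidableEq γ'] (c₉ : γ') (w : PEv → γ → γ')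
    {g : PGen γ} (hD : ∀ a ∈ baddr g.toGen, a.length ≤ D) {ab : List Bool × PEv}
    (hab : ab ∈ births (addrTag [] g.toGen)) :
    ∃ x, (ab.2, x) ∈ g.pbirths ∧ evalA c₉ (PGen.placed (D := D) c₉ w g) ab.1 = w ab.2 x := by
  have h := image_births_addrTag_nil c₉ g.toGen (PGen.placed (D := D) c₉ w g)
  rw [PGen.bread_placed c₉ w g hD] at h
  have hmem : (ab.2, evalA c₉ (PGen.placed (D := D) c₉ w g) ab.1) ∈
      (births (addrTag [] g.toGen)).image fun lb => (lb.2, evalA c₉ (PGen.placed (D := D) c₉ w g) lb.1) :=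
    mem_image_of_mem _ hab
  rw [h, Multiset.mem_toFinset, Multiset.mem_map] at hmem
  obtain ⟨⟨b, x⟩, hbx, heq⟩ := hmem
  simp only [Prod.mk.injEq] at heq
  obtain ⟨rfl, hv⟩ := heq
  exact ⟨x, hbx, hv.symm⟩

variable {hN hM}

/-- **THE SIDE CONDITIONS HOLD FOR THE MEMBER's PLACEMENT** (template sizes by `card_tmplV_le`, cells by
`isScale_cellV`, the root clause by leaf steps = label steps), when its births' levels are `≤ K`. [folklore] -/
theorem ok_placed (hL : 0 < L) {g : PGen (Pt d × Finset (Pt d))} (hD : ∀ a ∈ baddr g.toGen, a.length ≤ D)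
    (hK : ∀ bz ∈ g.pbirths, lv bz.1.step ≤ K) :
    OK n L K lv c₀ (PGen.placed (D := D) c₀ (valP n L K hN lv M hM) g) g.toGen := by
  refine ⟨fun ab hab => ?_, ?_⟩
  · obtain ⟨x, hx, hv⟩ := exists_value_of_mem_births c₀ (valP n L K hN lv M hM) hD hab
    rw [hv]
    exact ⟨card_tmplV_le hM _ _, isScale_cellV hN hL (hK _ hx) _⟩
  · obtain ⟨x, hx, hv⟩ :=
      exists_value_of_mem_births c₀ (valP n L K hN lv M hM) hD (root_mem_births_addrTag g.toGen)
    have hrs : g.toGen.rootStep = (g.toGen.root).step :=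
      rootStep_eq_root_step (fun b j hS => leafStep_toGen g b j hS) (Sub.refl _)
    rw [hrs]
    show IsScale L (lv g.toGen.root.step)
      (evalA c₀ (PGen.placed (D := D) c₀ (valP n L K hN lv M hM) g) (rootAddr g.toGen)).1
    rw [hv]
    exact isScale_cellV hN hL (hK _ hx) _

/-- **THE CORE ZONE OF THE MEMBER's PLACEMENT IS THE CORE ZONE OF ITS REDUCED BIRTH REGIONS** (leaf-07 gen 2's
`coreZoneD … regR …` of the payload-tagged tree), under the birth facts and levels `≤ K`. [folklore] -/
theorem coreZoneD_placed (hL : 0 < L) {g : PGen (Pt d × Finset (Pt d))} (hD : ∀ a ∈ baddr g.toGen, a.length ≤ D)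
    (hK : ∀ bz ∈ g.pbirths, lv bz.1.step ≤ K)
    (hF : ∀ bz ∈ g.pbirths,
      bz.2.1 ∈ bz.2.2 ∧ FaceConnected bz.2.2 ∧ treeLen bz.2.2 ≤ (bz.1.fat : ℝ) ∧ tcap d bz.1.fat ≤ M)
    (t : ℕ) :
    coreZoneD Prod.snd L lv (regOf n L K lv c₀ (PGen.placed (D := D) c₀ (valP n L K hN lv M hM) g)) t
        (addrTag [] g.toGen) =
      coreZoneD Prod.fst L lv (regR Prod.fst Prod.snd n L K lv) t (toGenL g) := by
  have h := image_births_addrTag_nil c₀ g.toGen (PGen.placed (D := D) c₀ (valP n L K hN lv M hM) g)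
  rw [PGen.bread_placed c₀ _ g hD] at h
  unfold coreZoneD regOf
  rw [← image_biUnion (f := fun ab : List Bool × PEv =>
      (ab.2, evalA c₀ (PGen.placed (D := D) c₀ (valP n L K hN lv M hM) g) ab.1))
    (t := fun bv => if bv.1.step ≤ t then
      blocks (L ^ (lv t - lv bv.1.step))
        (redZone (n * L ^ (K - lv bv.1.step)) (translate bv.2.2 (anchorZ L lv bv.2.1 bv.1.step))) else ∅),
    h, births_toGenL, Multiset.toFinset_map, image_biUnion]
  refine biUnion_congr rfl fun bz hbz => ?_
  rw [Multiset.mem_toFinset] at hbz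
  simp only
  split_ifs with h
  · rw [redZone_translate_valP hN hL hM (hK bz hbz) (hF bz hbz)]
    rfl
  · rfl

/-- **THE CONCRETE ZONE OF THE MEMBER's PLACEMENT IS THE LEVELLED REGION READING OF ITS PAYLOAD-TAGGED TREE**, at
levels `lv t ≤ K`. [folklore] -/
theorem zoneP_placed (hL : 0 < L) {g : PGen (Pt d × Finset (Pt d))} (hD : ∀ a ∈ baddr g.toGen, a.length ≤ D)
    (hK : ∀ bz ∈ g.pbirths, lv bz.1.step ≤ K)
    (hF : ∀ bz ∈ g.pbirths,
      bz.2.1 ∈ bz.2.2 ∧ FaceConnected bz.2.2 ∧ treeLen bz.2.2 ≤ (bz.1.fat : ℝ) ∧ tcap d bz.1.fat ≤ M)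
    {t : ℕ} (ht : lv t ≤ K) :
    zoneP n L K lv c c₀ t g.toGen (PGen.placed (D := D) c₀ (valP n L K hN lv M hM) g) =
      regZoneD Prod.fst n L K lv c (regR Prod.fst Prod.snd n L K lv) t (toGenL g) := by
  rw [zoneP_eq_of_ok (ok_placed (c₀ := c₀) hL hD hK) ht]
  unfold regZoneD
  rw [coreZoneD_placed hL hD hK hF]

/-- **THE ROOT VALUE OF THE MEMBER's PLACEMENT** is `valP (root label) (root payload)` (leaf-10 gen 6's
`evalA_placed_rootAddr`). [folklore] -/
theorem evalA_placed_rootAddr_valP {g : PGen (Pt d × Finset (Pt d))} (hD : ∀ a ∈ baddr g.toGen, a.length ≤ D) :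
    evalA c₀ (PGen.placed (D := D) c₀ (valP n L K hN lv M hM) g) (rootAddr g.toGen) =
      valP n L K hN lv M hM (Gen.root g.toGen) g.rootCell :=
  PGen.evalA_placed_rootAddr c₀ _ g hD

end

end Summit.QuantumFields.BalabanUV.T4Continuum.HistoryJoinsPlacedPhys
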